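import Mathlib
import HarnessLib
import HarnessLib.Audit
import Summits.KontsevichZagierPeriods.Statement

/-!
Route: BianchiHumbert

CLOSED (exhausted) 2026-08-16T03:06:18Z by planner-rchoice-KontsevichZagierPeriods-Bianch-5bb20c51-0 — reason: exhausted — note: route-choice (partial-claim hold, operator 2026-08-16T02:41Z): option (b) bank + close exhausted-with-result. RESULT: no sector theorem landed — 0 prover attempts on any item since open (2026-08-15T11:31Z); nothing to bank as Theorems. Banked artefacts (kept in the CLOSED file / ledger, re-wantable . The file is kept as the record of this route; refuted decls are indexed as negative knowledge (`ledger negatives`).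

# Route BianchiHumbert — Humbert's covolume formula as an accessible identity — Bianchi fundamental
domains cut-and-paste to L(2,χ), typed rational pairs for d = 1, 2, 3, 7

It suffices to show KZDimTwo, the DIMENSION-TWO STRATUM of the summit: any two KZ-rational integral
representations of
dimension ≤ 2 with the same value are KZ-equivalent (intermediates of any dimension allowed); with
the higher strata
(max dimension ≥ 3, named as the second antecedent of the Assembly) this is the summit by pure
logic. Route LowDimension
(Baker, d ≤ 1) deferred exactly d = 2; this route enters it through HYPERBOLIC COVOLUMES (card
bianchi-covolumes-pi-free-humbert).
For the five Euclidean rings O_d (d = 1, 2, 3, 7, 11) the Ford fundamental domain of the Bianchi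
group PSL₂(O_d) is
{z ∈ V_d} ∩ {|z|² + t² ≥ 1} over the Voronoi cell V_d of O_d (mod squares of units), so after the
change of variables
t = 1/s and one Newton–Leibniz move (primitive s²/2) the covolume is the RATIONAL double integral
∫∫_{V_d} dx dy/(2(1−x²−y²));
rescaling y by √|D| makes V_d a ℚ-polygon. Humbert's theorem covol(PSL₂(O_d)) =
|D|^{3/2}ζ_K(2)/(4π²) = |D|^{3/2}L(2,χ_D)/24
(Zagier1986 p.299, BurnsEtAl2021 Lemma 4.4) and L(2,χ_D) = ∫∫_{(0,1)²} P_D(xy)/(1−(xy)^{|D|}) dx dy,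
P_D(u) = Σ_{k<|D|} χ_D(k)u^{k−1},
turn "covolume = L-value" into an ACCESSIBLE IDENTITY in the sense of KontsevichZagier2001 §1.2
between two rational double
integrals over rational polygons: π never appears, no Eisenstein series, no regulator. The cruxes
are four of these five
identities (all numerically checked to 1e−13 this session); the mechanism that should prove them is
"fundamental domains
commute with moves": Poincaré extensions of ℚ̄-Möbius maps satisfy the Jacobian side condition of
KZ.changeOfVariablesRel
for the density t⁻³ and domain additivity is cut-and-paste, so Zagier's Theorem 3 (12·covol = Σ n_ν
D(z_ν), z_ν ∈ K) and
the Bianchi-tessellation element β_geo of BurnsEtAl2021 become statements inside KZ.relations.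
Lean: `∀ ⦃n m : ℕ⦄, n ≤ 2 → m ≤ 2 → ∀ (r : Literature.NumberTheory.Transcendental.KZ.IntegralRep n)
(r' : Literature.NumberTheory.Transcendental.KZ.IntegralRep m), r.IsRational → r'.IsRational →
r.value = r'.value → Literature.NumberTheory.Transcendental.KZ.Equivalent r r'`

## Assembly
Pure logic (proved in the planner's Sketch.lean, rc 0): given r : IntegralRep n, r' : IntegralRep m
rational with equal
value, if max n m ≤ 2 apply KZDimTwo, else apply the second antecedent (the higher strata, max n m ≥
3 — named explicitly
as what this route does NOT address; it is LowDimension's stratification cut at d = 2). The four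
Humbert cruxes are
instances of KZDimTwo (both reps 2-dim rational), the sector this route can reach; they do not by
themselves imply KZDimTwo.

Rationale: WHY THIS LINE. KontsevichZagier2001 §3.3 (p. 22) singles out Zagier's formulas for ζ_F(2) as
"accessible" identities in the sense of §1.2,
and Zagier1986 p.287 records for D = −7: "I know of no direct proof of the equality of the
right-hand sides of (5) [cyclotomic,
= L(2,χ)] and (6) [geometric, = covolume]"; BaileyEtAl2006 eqs. (12)–(13) checked the √7 form to
20,000 digits with "no proof
known", BaileyEtAl2010 §5 traced it back to Zagier's two 1986 theorems and asked for "a more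
transparent method" and for the
still-open siblings D = −8, −11, −15, −20, −24. A move-proof of HumbertSeven/HumbertTwo IS that
direct proof; conversely
BurnsEtAl2021 Prop 4.10 (β_geo = β_cyc in B̄(ℚ(ζ_N)), via Borel1977 regulator injectivity + Humbert)
together with the
scissors-congruence transfer of card hyperbolic-bloch-sector (five-term = 2–3 Pachner = two
domain-additivity moves,
DupontSah1982, NeumannZagier1985, Suslin1991) and torsion-freeness of P_KZ shows these identities
are KZ-accessible in
principle — so the cruxes are TRUE instances of the summit whose Lean closure needs either an
explicit five-term certificate
in ℤ[ℚ(ζ_N)] (open; "much more difficult to compute explicitly in B̄(F)", BurnsEtAl2021 §4.4) or,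
for N = 3, 4 (rational
dihedral angles, k = ℚ(ζ_N)), only the Clausen distribution calculus. Imported areas: arithmetic
Kleinian groups / Bianchi
groups (Swan1971, ElstrodtGrunewaldMennicke1998, Zagier1986, BurnsEtAl2021), scissors congruence and
Bloch groups
(DupontSah1982, Goncharov1999), Borel's regulator (Borel1977), experimental mathematics
(BaileyEtAl2006, BaileyEtAl2010).
What no other route has: typed L-VALUE identities (every typed calibration in the ledger so far is a
rational/log/π/G
identity) arranged as one uniform ladder N = 3, 4 | 8 | 7 (| 11) in which only the cyclotomic degree
[ℚ(ζ_N):k] grows.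

RANKED CRUXES. #0 KZDimTwo (target) — the dimension-two stratum: for n, m ≤ 2, KZ-rational reps r :
IntegralRep n, r' : IntegralRep m with equal value are KZ-equivalent. (why it might fail: contains
every 2-dim accessible identity (Humbert family, five-term at algebraic points, Legendre's relation
as areas, ζ(2) = π²/6); one additive invariant of FormalRep killing the four move sets and
separating one equal-valued pair refutes it and the summit.) [KontsevichZagier2001, Zagier1986,
HuberMullerStachPeriods2017]
#2 HumbertSeven (crux) — Humbert at d = 7 in rational form: the quarter Ford-domain rep [{0<x<1/2,
0<v<2−x}, 1/(7−7x²−v²)] (= covol(PSL₂(O₇))/(2√7), Voronoi hexagon |x| ≤ 1/2, |x|+√7|y| ≤ 2 rescaled)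
is KZ-equivalent to [(0,1)², 7(1+u−u²+u³−u⁴−u⁵)/(48(1−u⁷))], u = xy (= (7/48)·L(2,χ₋₇)); both
0.1679891311211. Zagier's (5) = (6) for D = −7 as one move chain. [difficulty: open-problem] (why it
might fail: known proofs are Humbert (Eisenstein series) or Borel regulator injectivity
(BurnsEtAl2021 Prop 4.10); no explicit five-term certificate in ℤ[ℚ(ζ₇)] is known and its size is
unbounded a priori, so a Lean proof needs that certificate or Borel as a named-fact hypothesis.)
[Zagier1986, BurnsEtAl2021, BaileyEtAl2006, BaileyEtAl2010, Borel1977, DupontSah1982]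
#3 PicardCatalan (crux) — Humbert at d = 1: the Picard rep [{|x|<1/2, 0<y<1/2}, 1/(2(1−x²−y²))] (=
covol PSL₂(ℤ[i]) after t-integration over the Ford domain |x| ≤ 1/2, 0 ≤ y ≤ 1/2, |z|²+t² ≥ 1) is
KZ-equivalent to [(0,1)², 1/(3(1+x²y²))]; both = G/3 = 0.3053218647257. Paper route: F = 4Θ with Θ =
{0<y<x<1/2} the [3,4,4] orthoscheme shadow (reflections), slope coordinates, unfolded logs,
triplication 4cos²θ−1 = sin3θ/sinθ as a 3-to-1 algebraic map + domain additivity, Λ(3π/4) = −Λ(π/4)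
by reflection, Euler's ∫₀^{π/2} log(2 sin) = 0 by duplication: value (1/6)Λ(π/4) = G/12, every step
LINEAR in the classes. [difficulty: L] (why it might fail: the Clausen duplication/triplication
steps are 2-to-1 and 3-to-1 algebraic maps of the circle that must be cut into injective
semialgebraic cells; the unfolded-log 3-dim intermediates have log-singular fibres that must stay
absolutely integrable; a step yielding only 2·(identity) needs TorsionFree.) [Zagier1986,
Milnor1982, JohnsonEtAl1999, KontsevichZagier2001, Zagier2007Dilogarithm]
#4 EisensteinDirichlet (crux) — Humbert at d = 3: the rep [{0<x<1/2, −x/3<v<(1−x)/3},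
1/(2(1−x²−3v²))] (= covol PSL₂(ℤ[ω])/√3: a third of the Voronoi hexagon, y = √3·v) is KZ-equivalent
to [(0,1)², 1/(8(1+xy+x²y²))] (= L(2,χ₋₃)/8); both 0.0976628016121 (covol = 0.1691569 =
vol(figure-eight)/12 = 4·covol[3,3,6]). Paper route: Ford domain = 4 orthoschemes of [3,3,6];
Clausen calculus at π/3, π/6 (Cl₂(2π/3) = (2/3)Cl₂(π/3) by duplication), L(2,χ₋₃) = (2/√3)Cl₂(2π/3)
by partial fractions of 1/(1+u+u²) over ℚ(√−3). [difficulty: L] (why it might fail: same engine as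
PicardCatalan at angle π/3: the duplication Cl₂(2θ) = 2Cl₂(θ) − 2Cl₂(π−θ) at θ = π/3 and the
partial-fraction passage through ℚ(√−3)-coefficients (real/imaginary parts separately) must stay
inside real ℚ-semialgebraic integrands with integrable unfolded logs.) [Zagier1986, Milnor1982,
JohnsonEtAl1999, BaileyEtAl2010, Zagier2007Dilogarithm]
#5 HumbertTwo (crux) — Humbert at d = 2 (N = 8), the lowest irrational-angle rung: the quarter
Ford-domain rep [(0,1/2)², 1/(1−x²−2v²)] (= covol PSL₂(ℤ[√−2])/(2√2); Voronoi rectangle |x| ≤ 1/2,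
|y| ≤ √2/2, y = √2·v) is KZ-equivalent to [(0,1)², (1+x²y²)/(3(1+x⁴y⁴))] (= L(2,χ₋₈)/3); both
0.3549113903478. Cyclotomic degree [ℚ(ζ₈):k] = 2 — the smallest field in which an explicit β_geo =
β_cyc certificate can be searched; BaileyEtAl2010 eq. (d8) is the open Clausen sibling. [difficulty:
XL] (why it might fail: as HumbertSeven one rung down: truth is Humbert's theorem, accessibility in
principle is Borel + transfer, but no explicit certificate in ℤ[ℚ(ζ₈)] relating the
ℤ[√−2]-tessellation element to 8([ζ₈]+[ζ₈³]) is known (BurnsEtAl2021 Rem 4.6 flags k = ℚ(√−2) as the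
awkward case, stabiliser of order 24).) [BurnsEtAl2021, BaileyEtAl2010, Zagier1986, Swan1971,
Borel1977]
#9 PicardTetrahedronScissors (support) — commensurability-scissors calibration, provable now:
3·[Picard rep] − [ideal tetrahedron T(∞,0,1,i) rep {x,y>0, x+y<1}, 1/(2(x+y−x²−y²))] ∈ KZ.relations
(values G/3 and G = 2Λ(π/4)). Proof plan in the 3-dim lift: F = 4Θ (reflections x ↦ −x, x ↔ y), T =
12Θ (barycentric subdivision of the regular ideal octahedron {0, ∞, ±1, ±i}: T = cone(c,(0,1,i)) ∪
cone(c,(∞,1,i)), c = (0,0,1); each of the 12 orthoschemes is g·Θ for g in the Coxeter group [3,4,4],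
whose sphere inversions (z,t) ↦ (z̄,t)/(|z|²+t²) are ℚ(i)-rational semialgebraic CoV with |det| =
(|z|²+t²)⁻³ matching t⁻³), descend by t = 1/s + Newton–Leibniz; then 3[F] − [T] = 3([F] − 4[Θ]) −
([T] − 12[Θ]). [difficulty: provable-now] [JohnsonEtAl1999, Milnor1982, Thurston1997,
BenedettiPetronio1992]
#9 TorsionFree (support) — P_KZ = FormalRep/relations is torsion-free: n ≠ 0, n • c ∈ KZ.relations ⇒
c ∈ KZ.relations (scale every integrand by 1/n: the four move sets are closed under it and n·[σ,
f/n] ~ [σ, f] by integrand additivity). Shared with route CoactionDevissage (same signature); needed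
to pass from 3[F] ~ [T]-type scissors statements and from Bloch-group certificates with multiplicity
to KZ.Equivalent. [difficulty: provable-now] [KontsevichZagier2001]

TWO-LAYER PLAN. HumbertSeven ⇐ SevenScissors → SevenCertificate → CyclotomicToL → HumbertSeven (k =
3): SevenScissors = Zagier's Theorem 3 as
moves, 12·[F₇, t⁻³] ~ Σ n_ν ρ(z_ν) with ρ(z) = [T(∞,0,1,z), t⁻³], z_ν ∈ ℚ(√−7) (equidecomposition of
fundamental domains of
PSL₂(O₇) and of a torsion-free finite-index subgroup by finitely many group elements; provable);
SevenCertificate = an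
explicit ℤ-combination of five-term/2-2 relators in ℤ[ℚ(ζ₇)♭] equal to 2Σ n_ν[z_ν] − 7Σ_k χ(k)[ζ₇^k]
(exists by BurnsEtAl2021
Prop 4.10; each relator is a Pachner 2–3 configuration = two domainAdd moves + isometries);
CyclotomicToL = Σ_k χ(k)ρ(ζ₇^k) ~
√7·[L-rep] (partial fractions u·P₇(u)/(1−u⁷) = τ(χ)⁻¹Σ_j χ(j)ζ^j u/(1−ζ^j u), real/imaginary parts,
plus Milnor's
vol T(z) = D(z) as moves). PicardCatalan ⇐ PicardTetrahedronScissors → TetrahedronCatalan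
([T(∞,0,1,i)] ~ [(0,1)², 1/(1+x²y²)],
"D(i) = G as moves") → (TorsionFree) PicardCatalan (k = 2). Nothing here is filed now.

KILL CRITERIA. Refutation of any typed Humbert identity or of PicardTetrahedronScissors (an additive
invariant FormalRep →+ A vanishing on
the four move sets and separating the pair) refutes KZDimTwo AND the summit: close `refuted:<Decl>`,
hand the invariant to
route Neg, alert the operator — but the values ARE equal (Humbert's theorem; 1e−13 checks in the
planner's num/check.py), so
a refuter must first re-derive the constants (Voronoi cell, √|D| rescaling, P_D). If card
hyperbolic-bloch-sector's Transfer
is refuted (some Dupont–Sah relator not realisable with null overlaps), HumbertSeven/HumbertTwo lose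
their in-principle
proof: pivot them to certificate-only statements and say so in the rationale. If an N = 8
certificate search provably
exceeds feasible size, restate HumbertTwo/HumbertSeven conditionally on named facts (Borel1977
injectivity, Suslin1991,
BurnsEtAl2021 Prop 4.10) — a tenure edit, not a close. KZDimTwo proved elsewhere moots the cruxes
(keep as calibrations).

NOT DECOMPOSED YET. HumbertEleven (typed shape ready: [{0<x<1/2, 0<v<3−x}, 1/(11−11x²−v²)] ~
(11/48)·L(2,χ₋₁₁)-rep, checked 1e−13; cyclotomic
degree 10) and all non-Euclidean d (several floor hemispheres; class number > 1 meets Zagier1986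
§5's partial-zeta
obstacle); the general equidecomposition lemma as a Literature theorem (needs Kleinian groups / ℍ³
in Lean — absent from
Mathlib); Milnor-as-moves vol T(z) = D(z) and the Poincaré-extension Jacobian lemma as separate
items (layer 2, shared with
card hyperbolic-bloch-sector — left to whoever opens that route); the 3-dim lifts [F_d, t⁻³]
themselves (one CoV + one NL
away from the filed 2-dim reps).

CHEAPEST FALSIFIER. (i) Re-run the quadrature: each filed LHS/RHS pair must agree (planner:
Gauss–Legendre 60-pt × 4 panels, pure Python,
all five |Δ| < 1e−13; a typo in a filed constant is the only cheap kill and would show at 1e−3).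
(ii) PicardCatalan on paper:
push the six-step chain (F = 4Θ, slope coordinates, unfold log, triplication cells, log-sine
duplication, reflection) through
the side conditions of changeOfVariablesRel — the 3-to-1 map (c,s) ↦ (4c³−3c, 3s−4s³) must be cut
into injective arcs with
HasFDerivWithinAt on each cell. (iii) Lookup: an explicit B̄(ℚ(ζ₈)) or B̄(ℚ(ζ₇)) certificate in the
BurnsEtAl2021 data
(their §6 tables work in B̄(k), not B̄(F)) or in Gangl's ladders would collapse
HumbertTwo/HumbertSeven to bookkeeping.

NUMBERS. Covolumes (Humbert, |D|^{3/2}L(2,χ_D)/24): PSL₂(ℤ[i]) = G/3 = 0.3053218647; PSL₂(O₃) =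
√3·L(2,χ₋₃)/8 = 0.1691569 (= 2.0298832/12,
figure-eight; = 2·covol PGL₂(O₃) = 4·covol[3,3,6] = 4·0.0422892336); PSL₂(O₂) = 2√2·L(2,χ₋₈)/3 =
1.0038; PSL₂(O₇) =
7√7·L(2,χ₋₇)/24 = 0.8889; PSL₂(O₁₁) = 11√11·L(2,χ₋₁₁)/24 = 1.3826. L-values: L(2,χ₋₃) =
0.7813024129, G = 0.9159655942,
L(2,χ₋₇) = 1.1519254705, L(2,χ₋₈) = 1.0647341710, L(2,χ₋₁₁) = 0.9095391053. Coxeter orthoschemes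
(JohnsonEtAl1999):
[3,4,4] = G/12 = 0.0763304662 (= Picard/4), [3,3,6] = 0.0422892336. Filed 2-dim values:
0.1679891311211 (Seven),
0.3053218647257 (Picard), 0.0976628016121 (Eisenstein), 0.3549113903478 (Two), tetrahedron
T(∞,0,1,i) = G. Items at open: 8.

DEFINITION REQUESTS. IdealTetrahedronRep (z : ℂ, 0 < z.im): the 3-dim representation [T(∞,0,1,z),
t⁻³] — domain {(x,y,t) : (x,y) in the open
Euclidean triangle (0,1,z), t² > R(z)² − |(x,y) − c(z)|²} with c, R the circumcentre/radius of
(0,1,z) (rational in Re z, Im z),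
integrand t⁻³; value D(z) (Milnor). Topic Literature/NumberTheory/Transcendental; wanted for the
layer-2 items of HumbertSeven
and shared with card hyperbolic-bloch-sector. Facts wanted later as hypotheses (cite items, not
filed now): Borel1977
regulator injectivity on K₃^ind(F) ⊗ ℚ; Suslin1991 B(F) ⊗ ℚ ≅ K₃^ind(F) ⊗ ℚ; BurnsEtAl2021 Prop
4.10.

Novelty: Searches (2026-08-15): `lit search --source zbmath "hyperbolic manifolds special values Dedekind
zeta functions Zagier"` (3: Zagier1986,
Zagier 1988, Goncharov 1993); `--source crossref "Ten problems in experimental mathematics"` (found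
BaileyEtAl2006, read eqs. (12)–(14));
`--source crossref "Hyperbolic tessellations and generators of K3 for imaginary quadratic fields"`
(BurnsEtAl2021, read §4 in full);
`lit read doi:10.2172/964375` → arXiv:1005.0414 = BaileyEtAl2010 §5 (read: status of D = −7, −8,
−11, −15, −20, −24);
`--source crossref "proof of a conjectured dilogarithm identity L_{-7}(2) Clausen"` (0 relevant),
`--source zbmath "Kontsevich Zagier
period conjecture hyperbolic volume"` (0), `--source crossref "accessible identity Kontsevich Zagier
periods hyperbolic 3-manifold volume"`
(7: HMS 2017, KZ2001, Viu-Sos thesis, CressonViusos2022, Viusos2020 — none on covolumes); held texts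
read: KontsevichZagier2001 pp. 7–8
("accessible identity"), p. 22 (§3.3); Zagier1986 pp. 285–287, 298–300; Borwein–Bailey 2008 p. 71
ex. 34(d); `lit galaxy search
"elementary proof of Humbert's formula" --star all` queued out (service saturated; retry noted); AMS
Notices 2011 PDF rate-limited
(acq-02321). Nearest prior art found: Zagier1986 (Thm 3: 12·covol is an integral combination of
D(z), z ∈ K, by triangulating
a Bianchi fundamental domain; p. 287 "no direct proof" of (5) = (6)); BurnsEtAl2021
(doi:10.1017/fms.2021.9: β_geo from ideal
tessellations of Bianchi groups, Lemma 4.4 Humbert, P  [refs: 10.2172/964375`, 10.1017/fms.2021.9:, 1005.0414, doi:10.2172/964375, doi:10.1017/fms.2021.9, Zagier1986, BaileyEtAl2006, BurnsEtAl2021, BaileyEtAl2010, CressonViusos2022, Viusos2020, KontsevichZagier2001, Goncharov1999, DupontSah1982]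

Barriers (technique_class: scissors-congruence arithmetic-groups hyperbolic-volume): - technique_class: scissors-congruence arithmetic-groups hyperbolic-volume
- Literature.Barriers.KontsevichZagierPeriods.kzConjecture_implies_oddZetaAlgIndep: applies verbatim
only to the target KZDimTwo (summit-strength stratum, admitted); the four Humbert cruxes assert
accessibility of identities already PROVED true (Humbert) and prove no number transcendental or
independent, so they fall outside the strength barrier's class.
- Literature.Barriers.KontsevichZagierPeriods.kzConjecture_implies_twoPiI_log_algIndep: same — only
KZDimTwo inherits it; no crux claims an independence statement.
- Literature.Barriers.KontsevichZagierPeriods.kzConjecture_implies_ellipticPeriods_algIndep: same —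
KZDimTwo contains the 2-dim elliptic sector, the cruxes do not touch it.
- Literature.Barriers.KontsevichZagierPeriods.noSemialgebraicPrimitive_inv_sub_two: evaded — the
only Newton–Leibniz primitives the line uses are s²/2 (t = 1/s descent) and H/u-type primitives of
unfolded logarithms (route LiouvilleUnfolding's device); no primitive of an algebraic function is
ever demanded as a function, and logs are kept as an extra fibre.
- Literature.Barriers.KontsevichZagierPeriods.cressonViuSos_prop_3_2: not engaged — the mechanism IS
dissection (domain additivity by finitely many group translates) plus isometries on pieces; no
global semialgebraic homeomorphism between the two reps is claimed, and dimension 3 < 5 makes the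
Hauptvermutung hypothesis vacuous.
- Literature.Barriers.KontsevichZagierPeri

History (route lifecycle, newest last):
- 2026-08-16T02:18:01Z · AUTO-CRUX: 1 conjecture-grade item(s) promoted to crux (SummitOffDimTwo) — refuter vetting / tiering apply (operator:999:1362873)
- 2026-08-16T03:06:18Z · CLOSED exhausted — exhausted (planner-rchoice-KontsevichZagierPeriods-Bianch-5bb20c51-0)

sub-problem: KontsevichZagierPeriods · status: closed(exhausted) · opened planner-plancard-KontsevichZagierPeriods-Kont-49dbefc6-0 2026-08-15T11:31:27Z · rev 2 · ledger route-KontsevichZagierPeriods-BianchiHumbert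
GENERATED by the gate from the ledger (D-0016/17). Provers cite these decls: `theorem foo : Summit.KontsevichZagierPeriods.KontsevichZagierPeriods.Theses.BianchiHumbert.<Decl> := …` in Summits/KontsevichZagierPeriods/KontsevichZagierPeriods/Theorems/<Name>.lean.
-/

namespace Summit.KontsevichZagierPeriods.KontsevichZagierPeriods.Theses.BianchiHumbert

open scoped BigOperators Topology Manifold Classical MeasureTheory ProbabilityTheory Matrix InnerProductSpace ComplexConjugate ContinuousMap
open Filter Set Function TopologicalSpace MeasureTheory

attribute [summit_statement] _root_.KontsevichZagierPeriods

open Literature Periods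

/-- item stmt-KontsevichZagierPeriods-4280 · target · rank 0 · open · by planner
why it might fail: contains every 2-dim accessible identity (Humbert family, five-term at algebraic points, Legendre's relation as areas, ζ(2) = π²/6); one additive invariant of FormalRep killing the four move sets and separating one equal-valued pair refutes it and the summit.
sources: KontsevichZagier2001, Zagier1986, HuberMullerStachPeriods2017
[target] the dimension-two stratum: for n, m ≤ 2, KZ-rational reps r : IntegralRep n, r' :
IntegralRep m with equal value are KZ-equivalent. -/
@[route_item "route-KontsevichZagierPeriods-BianchiHumbert"]
def KZDimTwo : Prop :=
  ∀ ⦃n m : ℕ⦄, n ≤ 2 → m ≤ 2 → ∀ (r : Literature.NumberTheory.Transcendental.KZ.IntegralRep n) (r' : Literature.NumberTheory.Transcendental.KZ.IntegralRep m), r.IsRational → r'.IsRational → r.value = r'.value → Literature.NumberTheory.Transcendental.KZ.Equivalent r r'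

/-- item stmt-KontsevichZagierPeriods-4281 · crux · rank 2 · closed · moot by None · by planner
why it might fail: known proofs are Humbert (Eisenstein series) or Borel regulator injectivity (BurnsEtAl2021 Prop 4.10); no explicit five-term certificate in ℤ[ℚ(ζ₇)] is known and its size is unbounded a priori, so a Lean proof needs that certificate or Borel as a named-fact hypothesis.
sources: Zagier1986, BurnsEtAl2021, BaileyEtAl2006, BaileyEtAl2010, Borel1977, DupontSah1982
[crux] Humbert at d = 7 in rational form: the quarter Ford-domain rep [{0<x<1/2, 0<v<2−x},
1/(7−7x²−v²)] (= covol(PSL₂(O₇))/(2√7), Voronoi hexagon |x| ≤ 1/2, |x|+√7|y| ≤ 2 rescaled) is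
KZ-equivalent to [(0,1)², 7(1+u−u²+u³−u⁴−u⁵)/(48(1−u⁷))], u = xy (= (7/48)·L(2,χ₋₇)); both
0.1679891311211. Zagier's (5) = (6) for D = −7 as one move chain. [difficulty: open-problem] -/
@[route_item "route-KontsevichZagierPeriods-BianchiHumbert"]
def HumbertSeven : Prop :=
  ∀ (r r' : Literature.NumberTheory.Transcendental.KZ.IntegralRep 2), r.domain = {z | 0 < z 0 ∧ z 0 < 1 / 2 ∧ 0 < z 1 ∧ z 1 < 2 - z 0} → Set.EqOn r.integrand (fun z => 1 / (7 - 7 * z 0 ^ 2 - z 1 ^ 2)) r.domain → r'.domain = {z | 0 < z 0 ∧ z 0 < 1 ∧ 0 < z 1 ∧ z 1 < 1} → Set.EqOn r'.integrand (fun z => 7 * (1 + z 0 * z 1 - (z 0 * z 1) ^ 2 + (z 0 * z 1) ^ 3 - (z 0 * z 1) ^ 4 - (z 0 * z 1) ^ 5) / (48 * (1 - (z 0 * z 1) ^ 7))) r'.domain → Literature.NumberTheory.Transcendental.KZ.Equivalent r r'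

/-- item stmt-KontsevichZagierPeriods-4282 · crux · rank 3 · closed · moot by None · by planner
why it might fail: the Clausen duplication/triplication steps are 2-to-1 and 3-to-1 algebraic maps of the circle that must be cut into injective semialgebraic cells; the unfolded-log 3-dim intermediates have log-singular fibres that must stay absolutely integrable; a step yielding only 2·(identity) needs TorsionFree.
sources: Zagier1986, Milnor1982, JohnsonEtAl1999, KontsevichZagier2001, Zagier2007Dilogarithm
[crux] Humbert at d = 1: the Picard rep [{|x|<1/2, 0<y<1/2}, 1/(2(1−x²−y²))] (= covol PSL₂(ℤ[i])
after t-integration over the Ford domain |x| ≤ 1/2, 0 ≤ y ≤ 1/2, |z|²+t² ≥ 1) is KZ-equivalent to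
[(0,1)², 1/(3(1+x²y²))]; both = G/3 = 0.3053218647257. Paper route: F = 4Θ with Θ = {0<y<x<1/2} the
[3,4,4] orthoscheme shadow (reflections), slope coordinates, unfolded logs, triplication 4cos²θ−1 =
sin3θ/sinθ as a 3-to-1 algebraic map + domain additivity, Λ(3π/4) = −Λ(π/4) by reflection, Euler's
∫₀^{π/2} log(2 sin) = 0 by duplication: value (1/6)Λ(π/4) = G/12, every step LINEAR in the classes.
[difficulty: L] -/
@[route_item "route-KontsevichZagierPeriods-BianchiHumbert"]
def PicardCatalan : Prop :=
  ∀ (r r' : Literature.NumberTheory.Transcendental.KZ.IntegralRep 2), r.domain = {z | |z 0| < 1 / 2 ∧ 0 < z 1 ∧ z 1 < 1 / 2} → Set.EqOn r.integrand (fun z => 1 / (2 * (1 - z 0 ^ 2 - z 1 ^ 2))) r.domain → r'.domain = {z | 0 < z 0 ∧ z 0 < 1 ∧ 0 < z 1 ∧ z 1 < 1} → Set.EqOn r'.integrand (fun z => 1 / (3 * (1 + z 0 ^ 2 * z 1 ^ 2))) r'.domain → Literature.NumberTheory.Transcendental.KZ.Equivalent r r'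

/-- item stmt-KontsevichZagierPeriods-4283 · crux · rank 4 · closed · moot by None · by planner
why it might fail: same engine as PicardCatalan at angle π/3: the duplication Cl₂(2θ) = 2Cl₂(θ) − 2Cl₂(π−θ) at θ = π/3 and the partial-fraction passage through ℚ(√−3)-coefficients (real/imaginary parts separately) must stay inside real ℚ-semialgebraic integrands with integrable unfolded logs.
sources: Zagier1986, Milnor1982, JohnsonEtAl1999, BaileyEtAl2010, Zagier2007Dilogarithm
[crux] Humbert at d = 3: the rep [{0<x<1/2, −x/3<v<(1−x)/3}, 1/(2(1−x²−3v²))] (= covol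
PSL₂(ℤ[ω])/√3: a third of the Voronoi hexagon, y = √3·v) is KZ-equivalent to [(0,1)²,
1/(8(1+xy+x²y²))] (= L(2,χ₋₃)/8); both 0.0976628016121 (covol = 0.1691569 = vol(figure-eight)/12 =
4·covol[3,3,6]). Paper route: Ford domain = 4 orthoschemes of [3,3,6]; Clausen calculus at π/3, π/6
(Cl₂(2π/3) = (2/3)Cl₂(π/3) by duplication), L(2,χ₋₃) = (2/√3)Cl₂(2π/3) by partial fractions of
1/(1+u+u²) over ℚ(√−3). [difficulty: L] -/
@[route_item "route-KontsevichZagierPeriods-BianchiHumbert"]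
def EisensteinDirichlet : Prop :=
  ∀ (r r' : Literature.NumberTheory.Transcendental.KZ.IntegralRep 2), r.domain = {z | 0 < z 0 ∧ z 0 < 1 / 2 ∧ -(z 0) / 3 < z 1 ∧ z 1 < (1 - z 0) / 3} → Set.EqOn r.integrand (fun z => 1 / (2 * (1 - z 0 ^ 2 - 3 * z 1 ^ 2))) r.domain → r'.domain = {z | 0 < z 0 ∧ z 0 < 1 ∧ 0 < z 1 ∧ z 1 < 1} → Set.EqOn r'.integrand (fun z => 1 / (8 * (1 + z 0 * z 1 + z 0 ^ 2 * z 1 ^ 2))) r'.domain → Literature.NumberTheory.Transcendental.KZ.Equivalent r r'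

/-- item stmt-KontsevichZagierPeriods-4284 · crux · rank 5 · closed · moot by None · by planner
why it might fail: as HumbertSeven one rung down: truth is Humbert's theorem, accessibility in principle is Borel + transfer, but no explicit certificate in ℤ[ℚ(ζ₈)] relating the ℤ[√−2]-tessellation element to 8([ζ₈]+[ζ₈³]) is known (BurnsEtAl2021 Rem 4.6 flags k = ℚ(√−2) as the awkward case, stabiliser of order 24).
sources: BurnsEtAl2021, BaileyEtAl2010, Zagier1986, Swan1971, Borel1977
[crux] Humbert at d = 2 (N = 8), the lowest irrational-angle rung: the quarter Ford-domain rep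
[(0,1/2)², 1/(1−x²−2v²)] (= covol PSL₂(ℤ[√−2])/(2√2); Voronoi rectangle |x| ≤ 1/2, |y| ≤ √2/2, y =
√2·v) is KZ-equivalent to [(0,1)², (1+x²y²)/(3(1+x⁴y⁴))] (= L(2,χ₋₈)/3); both 0.3549113903478.
Cyclotomic degree [ℚ(ζ₈):k] = 2 — the smallest field in which an explicit β_geo = β_cyc certificate
can be searched; BaileyEtAl2010 eq. (d8) is the open Clausen sibling. [difficulty: XL] -/
@[route_item "route-KontsevichZagierPeriods-BianchiHumbert"]
def HumbertTwo : Prop :=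
  ∀ (r r' : Literature.NumberTheory.Transcendental.KZ.IntegralRep 2), r.domain = {z | 0 < z 0 ∧ z 0 < 1 / 2 ∧ 0 < z 1 ∧ z 1 < 1 / 2} → Set.EqOn r.integrand (fun z => 1 / (1 - z 0 ^ 2 - 2 * z 1 ^ 2)) r.domain → r'.domain = {z | 0 < z 0 ∧ z 0 < 1 ∧ 0 < z 1 ∧ z 1 < 1} → Set.EqOn r'.integrand (fun z => (1 + (z 0 * z 1) ^ 2) / (3 * (1 + (z 0 * z 1) ^ 4))) r'.domain → Literature.NumberTheory.Transcendental.KZ.Equivalent r r'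

/-- item stmt-KontsevichZagierPeriods-10359 · crux (kind.auto-crux: conjecture-grade) · rank 9 · closed · moot by None · by planner
why it might fail: auto-crux — conjecture-grade statement (docstring avows it ('NOT CLAIMED BY THIS ROUTE')); it is open, so it may simply be false
sources: KontsevichZagier2001, HuberMullerStachPeriods2017
[support] NOT CLAIMED BY THIS ROUTE — the remainder of the summit off the dimension-two stratum: two
KZ-rational integral representations r : IntegralRep n, r' : IntegralRep m with 2 < max n m and
equal value are KZ-equivalent. It is verbatim the second antecedent of Assembly, now listed so that
the deciding theorem `closes` reaches `KontsevichZagierPeriods` by name with hypotheses among the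
route's items (D-0027 §2.1 glue-first; idiom of MotivatedMoves.SummitOffGammaSector /
ScissorsAvatars.OffSectorReduction / GammaCornerAnomaly.SummitOffMUMSector). Together with the
target KZDimTwo it partitions Conjecture 1 by max n m ≤ 2 ∨ 2 < max n m, and KZDimTwo stays
load-bearing (SummitOffDimTwo alone says nothing about pairs of dimension ≤ 2). Summit-strength (=
route LowDimension's stratification LowdimThesis above d = 2; barriers
kzConjecture_implies_oddZetaAlgIndep, kzConjecture_implies_twoPiI_log_algIndep apply verbatim: ζ(3)
= ∫∫∫_{(0,1)³} dxdydz/(1−xyz) already lives here). Do not staff; any route proving the summit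
(LowDimension, StandardParts, Deregularisation, NoriTransfer, Grothendieck) supersedes it. [deps:
Assembly] [difficulty: open-problem] -/
@[route_item "route-KontsevichZagierPeriods-BianchiHumbert"]
def SummitOffDimTwo : Prop :=
  ∀ ⦃n m : ℕ⦄ (r : Literature.NumberTheory.Transcendental.KZ.IntegralRep n) (r' : Literature.NumberTheory.Transcendental.KZ.IntegralRep m), 2 < max n m → r.IsRational → r'.IsRational → r.value = r'.value → Literature.NumberTheory.Transcendental.KZ.Equivalent r r'

/-- item stmt-KontsevichZagierPeriods-3169 · support · rank 9 · closed · proved by Summit.KontsevichZagierPeriods.CoactionDevissage.TorsionFree.exceptionalCouplings_torsionFree_proof @ f648441f8c8f (prover) · by planner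
sources: KontsevichZagier2001
[support] P_KZ is torsion-free: n ≠ 0, n • c ∈ KZ.relations ⇒ c ∈ KZ.relations. Proof: c − c·[0,1] ∈
relations (Newton–Leibniz on each generator r with base r, band r.domain × [0,1] = (r.prod
I₀₁).domain, F(x,t) = t·f(x)); c·[0,1] − n • (c·[0,1/n]) ∈ relations (domain additivity into n slabs
over the null overlaps r.domain × {k/n}, translations t ↦ t − k/n as changes of variables); n •
(c·[0,1/n]) = (n • c)·[0,1/n] ∈ relations by `KZ.mul_mem_relations_right_holds`. Card item D0.
[difficulty: provable-now] -/
@[route_item "route-KontsevichZagierPeriods-BianchiHumbert"]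
def TorsionFree : Prop :=
  ∀ (n : ℕ) (c : Literature.NumberTheory.Transcendental.KZ.FormalRep), n ≠ 0 → n • c ∈ Literature.NumberTheory.Transcendental.KZ.relations → c ∈ Literature.NumberTheory.Transcendental.KZ.relations

/-- item stmt-KontsevichZagierPeriods-4285 · support · rank 9 · closed · moot by None · by planner
sources: JohnsonEtAl1999, Milnor1982, Thurston1997, BenedettiPetronio1992
[support] commensurability-scissors calibration, provable now: 3·[Picard rep] − [ideal tetrahedron
T(∞,0,1,i) rep {x,y>0, x+y<1}, 1/(2(x+y−x²−y²))] ∈ KZ.relations (values G/3 and G = 2Λ(π/4)). Proof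
plan in the 3-dim lift: F = 4Θ (reflections x ↦ −x, x ↔ y), T = 12Θ (barycentric subdivision of the
regular ideal octahedron {0, ∞, ±1, ±i}: T = cone(c,(0,1,i)) ∪ cone(c,(∞,1,i)), c = (0,0,1); each of
the 12 orthoschemes is g·Θ for g in the Coxeter group [3,4,4], whose sphere inversions (z,t) ↦
(z̄,t)/(|z|²+t²) are ℚ(i)-rational semialgebraic CoV with |det| = (|z|²+t²)⁻³ matching t⁻³), descend
by t = 1/s + Newton–Leibniz; then 3[F] − [T] = 3([F] − 4[Θ]) − ([T] − 12[Θ]). [difficulty: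
provable-now] -/
@[route_item "route-KontsevichZagierPeriods-BianchiHumbert"]
def PicardTetrahedronScissors : Prop :=
  ∀ (r t : Literature.NumberTheory.Transcendental.KZ.IntegralRep 2), r.domain = {z | |z 0| < 1 / 2 ∧ 0 < z 1 ∧ z 1 < 1 / 2} → Set.EqOn r.integrand (fun z => 1 / (2 * (1 - z 0 ^ 2 - z 1 ^ 2))) r.domain → t.domain = {z | 0 < z 0 ∧ 0 < z 1 ∧ z 0 + z 1 < 1} → Set.EqOn t.integrand (fun z => 1 / (2 * (z 0 + z 1 - z 0 ^ 2 - z 1 ^ 2))) t.domain → (3 : ℕ) • Literature.NumberTheory.Transcendental.KZ.of r - Literature.NumberTheory.Transcendental.KZ.of t ∈ Literature.NumberTheory.Transcendental.KZ.relations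

/-- item stmt-KontsevichZagierPeriods-4286 · assembly · rank 1 · closed · moot by None · by planner
sources: KontsevichZagier2001
[assembly] KZDimTwo → (summit for pairs with max dimension ≥ 3) → KontsevichZagierPeriods. -/
@[route_item "route-KontsevichZagierPeriods-BianchiHumbert"]
def Assembly : Prop :=
  (∀ ⦃n m : ℕ⦄, n ≤ 2 → m ≤ 2 → ∀ (r : Literature.NumberTheory.Transcendental.KZ.IntegralRep n) (r' : Literature.NumberTheory.Transcendental.KZ.IntegralRep m), r.IsRational → r'.IsRational → r.value = r'.value → Literature.NumberTheory.Transcendental.KZ.Equivalent r r') → (∀ ⦃n m : ℕ⦄ (r : Literature.NumberTheory.Transcendental.KZ.IntegralRep n) (r' : Literature.NumberTheory.Transcendental.KZ.IntegralRep m), 2 < max n m → r.IsRational → r'.IsRational → r.value = r'.value → Literature.NumberTheory.Transcendental.KZ.Equivalent r r') → KontsevichZagierPeriods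

end Summit.KontsevichZagierPeriods.KontsevichZagierPeriods.Theses.BianchiHumbert
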